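import Summits.MatrixMultiplication.OmegaCensus.CubePairAlignmentChar
import Summits.MatrixMultiplication.OmegaCensus.CubePairClosure
import Summits.MatrixMultiplication.OmegaCensus.DihedralLawModOneCubeAlignedPair
import HarnessLib

/-!
# Cube pair near-tilings force a cyclic group

ω-census, family (b3).  Framing: lottery ticket; floor = certified bounds/negative ranges.

The cyclicity half of Lemma Q (`FAMILY-B-ADDENDUM-g4.md` §7) WITHOUT the alignment `t′ = ±t` and without the
coset counting of its case (c): if `M ⊔ (M+t) ⊔ P ⊔ (P+t′) = A ∖ {x₀}` (i) and
`M ⊔ (M+t′) ⊔ (P+t′) ⊔ (P+t′−t) = A ∖ {x₀′}` (ii′) (indicator forms, as in `aligned_of_generator`) with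
`|M| = 2|P|`, `|A| = 2|M| + 2|P| + 1`, then `A` is cyclic (**`exists_zmultiples_eq_top_of_near_tilings`**).
* `t′ = t`: (i) is a domino near-factorization `Z ⊔ (Z+t) = A ∖ {x₀}`, so `A = x₀ + ⟨t⟩`
  (`coset_eq_univ_of_domino_near_tiling`).
* `t′ ≠ t`, `u = t′−t`, `v = t+t′`, `k₁ = ord u`, `k₂ = ord v`: `A = ⟨u⟩ + ⟨v⟩` (parity, `CubePairClosure`) and
  `⟨u⟩ ∩ ⟨v⟩ = 0` (**`eq_zero_of_mem_zmultiples_of_near_tilings`**: for `w` in both, a character moving `w` moves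
  `u` and `v`, so Step 3 + Fourier inversion make `D = 𝟙_M − 𝟙_{P+h}` `w`-periodic, `ord w ∣ |P|, 6|P|+1`); hence
  `(i, j) ↦ i•u + j•v` is a bijection `[0,k₁) × [0,k₂) → A`.  Step 3 and Fourier inversion also kill the mixed
  second difference of `D` (`mixed_diff_eq_zero_of_charsum_eq`), so the `u`-orbit sums `S(z) = Σ_i D(z + i•u)`
  obey `S(z + j•v) = S(z) + k₁ (D(z + j•v) − D(z))`; summing over `j`: `|P| = Σ_A D = k₂ S(0) + k₁ (…)`, so
  `gcd(k₁, k₂) ∣ |P|` and `∣ 6|P| + 1`: `k₁ ⊥ k₂`, `ord(u + v) = k₁ k₂ = |A|`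
  (**`zmultiples_add_eq_top_of_near_tilings`**: `u + v = 2t′` generates `A`).
With the TPP wrapper (`cube_pair_indicator_identities`, `DihedralLawModOneCubePairGenerator.lean`): a law-attaining
TPP triple in a dihedral-like group whose cube part sizes contain a `2` forces `A` CYCLIC — e.g. no such triple
over `ℤ₅²` (shapes `(1,2,4)`, `(2,2,2)` at `|A| = 25`) or `ℤ₇²`.
-/

namespace Summit.MatrixMultiplication.OmegaCensus

open Finset

section Cyclic

variable {A : Type*} [AddCommGroup A] [Fintype A] [DecidableEq A]

/-- **Steps 2–3 packaged.** Under (i), (ii′), `|A| = 2|M| + 2|P| + 1` and `t′ ≠ t`, with `h := x₀′ − x₀`: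
`h + h = t′ − t` (`two_mul_eq_of_near_periodic_half_set` for `W = (M+t) ⊔ P`) and `M̂(ψ) = ψ(h) P̂(ψ)` whenever
`ψ(t′ − t) ≠ 1 ≠ ψ(t + t′)` (`charsum_M_eq_mul_charsum_P`). [folklore] -/
theorem charsum_eq_of_near_tilings {M P : Finset A} {t t' x₀ x₀' : A}
    (hi : ∀ y : A, ((if y ∈ M then (1 : ℤ) else 0) + (if y - t ∈ M then 1 else 0) + (if y ∈ P then 1 else 0) +
      (if y - t' ∈ P then 1 else 0)) = if y = x₀ then 0 else 1)
    (hii : ∀ y : A, ((if y ∈ M then (1 : ℤ) else 0) + (if y - t' ∈ M then 1 else 0) + (if y - t' ∈ P then 1 else 0) +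
      (if y - (t' - t) ∈ P then 1 else 0)) = if y = x₀' then 0 else 1)
    (hN : Fintype.card A = 2 * M.card + 2 * P.card + 1) (hu : t' - t ≠ 0) :
    (x₀' - x₀) + (x₀' - x₀) = t' - t ∧
      ∀ ψ : AddChar A ℂ, ψ (t' - t) ≠ 1 → ψ (t + t') ≠ 1 →
        ∑ x ∈ M, ψ x = ψ (x₀' - x₀) * ∑ x ∈ P, ψ x := by
  have hW : ∀ y : A, ((if y ∈ M.image (· + t) ∪ P then (1 : ℤ) else 0) -
      (if y - (t' - t) ∈ M.image (· + t) ∪ P then 1 else 0)) =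
      (if y = x₀' then (1 : ℤ) else 0) - (if y = x₀ then 1 else 0) := by
    intro y
    have h1 := hi y
    have h2 := hii y
    have e1 : (if y ∈ M.image (· + t) ∪ P then (1 : ℤ) else 0) =
        (if y - t ∈ M then (1 : ℤ) else 0) + (if y ∈ P then 1 else 0) := by
      have hmem : (y ∈ M.image (· + t) ∪ P) ↔ (y - t ∈ M ∨ y ∈ P) := by rw [mem_union, mem_image_add]
      by_cases ha : y - t ∈ M
      · by_cases hb : y ∈ P
        · exfalso; rw [if_pos ha, if_pos hb] at h1; split_ifs at h1 <;> omega
        · rw [if_pos (hmem.2 (Or.inl ha)), if_pos ha, if_neg hb]; norm_num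
      · by_cases hb : y ∈ P
        · rw [if_pos (hmem.2 (Or.inr hb)), if_neg ha, if_pos hb]; norm_num
        · rw [if_neg (fun h => (hmem.1 h).elim ha hb), if_neg ha, if_neg hb]; norm_num
    have e2 : (if y - (t' - t) ∈ M.image (· + t) ∪ P then (1 : ℤ) else 0) =
        (if y - t' ∈ M then (1 : ℤ) else 0) + (if y - (t' - t) ∈ P then 1 else 0) := by
      have hmem : (y - (t' - t) ∈ M.image (· + t) ∪ P) ↔ (y - t' ∈ M ∨ y - (t' - t) ∈ P) := by
        rw [mem_union, mem_image_add, show y - (t' - t) - t = y - t' by abel]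
      by_cases ha : y - t' ∈ M
      · by_cases hb : y - (t' - t) ∈ P
        · exfalso; rw [if_pos ha, if_pos hb] at h2; split_ifs at h2 <;> omega
        · rw [if_pos (hmem.2 (Or.inl ha)), if_pos ha, if_neg hb]; norm_num
      · by_cases hb : y - (t' - t) ∈ P
        · rw [if_pos (hmem.2 (Or.inr hb)), if_neg ha, if_pos hb]; norm_num
        · rw [if_neg (fun h => (hmem.1 h).elim ha hb), if_neg ha, if_neg hb]; norm_num
    rw [e1, e2]
    split_ifs at h1 h2 ⊢ <;> omega
  have hdisj : Disjoint (M.image (· + t)) P := by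
    rw [disjoint_left]
    intro y hy hyP
    have h1 := hi y
    rw [mem_image_add] at hy
    rw [if_pos hy, if_pos hyP] at h1; split_ifs at h1 <;> omega
  have cW : 2 * (M.image (· + t) ∪ P).card + 1 = Fintype.card A := by
    rw [card_union_of_disjoint hdisj, card_image_add, hN]; ring
  have hhole := two_mul_eq_of_near_periodic_half_set hu hW cW
  set h := x₀' - x₀ with hh
  have hx₀' : x₀' = x₀ + h := by rw [hh]; abel
  have hii' : ∀ y : A, ((if y ∈ M then (1 : ℤ) else 0) + (if y - t' ∈ M then 1 else 0) +
      (if y - t' ∈ P then 1 else 0) + (if y - (t' - t) ∈ P then 1 else 0)) = if y = x₀ + h then 0 else 1 := by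
    intro y; rw [← hx₀']; exact hii y
  have hchar := fun (ψ : AddChar A ℂ) => charsum_M_eq_mul_charsum_P hi hii' hhole ψ
  exact ⟨hhole, fun ψ => hchar ψ⟩

omit [DecidableEq A] in
/-- A character trivial on `g` is trivial on `⟨g⟩`. [folklore] -/
theorem addChar_apply_eq_one_of_mem_zmultiples {g w : A} (hw : w ∈ AddSubgroup.zmultiples g) {ψ : AddChar A ℂ}
    (hg : ψ g = 1) : ψ w = 1 := by
  classical
  obtain ⟨n, -, rfl⟩ := mem_image.1 ((mem_zmultiples_iff_mem_range_addOrderOf).1 hw)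
  rw [AddChar.map_nsmul_eq_pow, hg, one_pow]

/-- **`⟨t′ − t⟩ ∩ ⟨t + t′⟩ = 0`.**  Indicator forms of (i), (ii′) with `|M| = 2|P|`, `|A| = 2|M| + 2|P| + 1`: every
common element `w` of `⟨t′ − t⟩` and `⟨t + t′⟩` vanishes — a character moving `w` moves `t′−t` and `t+t′`, so
`𝟙_M − 𝟙_{P+h}` is `w`-periodic (`periodic_diff_of_charsum_eq`), `ord w ∣ |P|` and `ord w ∣ 6|P| + 1`.  Contains
`aligned_of_generator` (`⟨t+t′⟩ = A` ⇒ `⟨t′−t⟩ = 0`). [folklore] -/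
theorem eq_zero_of_mem_zmultiples_of_near_tilings {M P : Finset A} {t t' x₀ x₀' : A}
    (hi : ∀ y : A, ((if y ∈ M then (1 : ℤ) else 0) + (if y - t ∈ M then 1 else 0) + (if y ∈ P then 1 else 0) +
      (if y - t' ∈ P then 1 else 0)) = if y = x₀ then 0 else 1)
    (hii : ∀ y : A, ((if y ∈ M then (1 : ℤ) else 0) + (if y - t' ∈ M then 1 else 0) + (if y - t' ∈ P then 1 else 0) +
      (if y - (t' - t) ∈ P then 1 else 0)) = if y = x₀' then 0 else 1)
    (hMP : M.card = 2 * P.card) (hN : Fintype.card A = 2 * M.card + 2 * P.card + 1) {w : A}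
    (hwu : w ∈ AddSubgroup.zmultiples (t' - t)) (hwv : w ∈ AddSubgroup.zmultiples (t + t')) : w = 0 := by
  by_cases hu : t' - t = 0
  · rw [hu, AddSubgroup.zmultiples_zero_eq_bot, AddSubgroup.mem_bot] at hwu; exact hwu
  obtain ⟨-, hchar⟩ := charsum_eq_of_near_tilings hi hii hN hu
  set h := x₀' - x₀ with hh
  have hm : (M.card : ℤ) - (P.image (· + h)).card = P.card := by rw [card_image_add, hMP]; push_cast; ring
  have hN' : Fintype.card A = 6 * P.card + 1 := by rw [hN, hMP]; ring
  have hper : ∀ y : A, ((if y ∈ M then (1 : ℤ) else 0) - (if y ∈ P.image (· + h) then 1 else 0)) =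
      ((if y + w ∈ M then (1 : ℤ) else 0) - (if y + w ∈ P.image (· + h) then 1 else 0)) := by
    intro y
    simp only [mem_image_add]
    refine periodic_diff_of_charsum_eq (fun ψ hψw => hchar ψ ?_ ?_) y
    · exact fun h1 => hψw (addChar_apply_eq_one_of_mem_zmultiples hwu h1)
    · exact fun h1 => hψw (addChar_apply_eq_one_of_mem_zmultiples hwv h1)
  have hd := addOrderOf_dvd_card_sub_card hper
  rw [hm] at hd
  have hd' : addOrderOf w ∣ P.card := Int.natCast_dvd_natCast.1 hd
  have hdN : addOrderOf w ∣ Fintype.card A := addOrderOf_dvd_card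
  rw [hN'] at hdN
  have h1 : addOrderOf w ∣ 1 := (Nat.dvd_add_right (dvd_mul_of_dvd_right hd' 6)).1 hdN
  exact AddMonoid.addOrderOf_eq_one_iff.1 (Nat.dvd_one.1 h1)

/-- **Fourier inversion, mixed difference.** If `M̂(ψ) = ψ(h) P̂(ψ)` whenever `ψ(u) ≠ 1 ≠ ψ(v)`, then the mixed
second difference of `D = 𝟙_M − 𝟙_{P+h}` in directions `u, v` vanishes. [folklore] -/
theorem mixed_diff_eq_zero_of_charsum_eq {M P : Finset A} {h u v : A}
    (hMP : ∀ ψ : AddChar A ℂ, ψ u ≠ 1 → ψ v ≠ 1 → ∑ x ∈ M, ψ x = ψ h * ∑ x ∈ P, ψ x) (y : A) :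
    (((if y ∈ M then (1 : ℤ) else 0) - (if y - h ∈ P then 1 else 0)) -
      ((if y + u ∈ M then (1 : ℤ) else 0) - (if y + u - h ∈ P then 1 else 0)) -
      ((if y + v ∈ M then (1 : ℤ) else 0) - (if y + v - h ∈ P then 1 else 0)) +
      ((if y + u + v ∈ M then (1 : ℤ) else 0) - (if y + u + v - h ∈ P then 1 else 0))) = 0 := by
  -- `∑_ψ D̂(ψ) ψ(−z) = N · D(z)`
  have key : ∀ z : A, (∑ ψ : AddChar A ℂ, ((∑ x ∈ M, ψ x) - ψ h * ∑ x ∈ P, ψ x) * ψ (-z)) =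
      (Fintype.card A : ℂ) * ((if z ∈ M then (1 : ℂ) else 0) - (if z - h ∈ P then (1 : ℂ) else 0)) := by
    intro z
    have e1 : ∀ ψ : AddChar A ℂ, ((∑ x ∈ M, ψ x) - ψ h * ∑ x ∈ P, ψ x) * ψ (-z) =
        (∑ x ∈ M, ψ (x + -z)) - ∑ x ∈ P, ψ (x + (h + -z)) := by
      intro ψ
      rw [sub_mul, sum_mul, mul_comm (ψ h), mul_assoc, sum_mul]
      congr 1
      · exact sum_congr rfl fun x _ => (AddChar.map_add_eq_mul ψ x (-z)).symm
      · exact sum_congr rfl fun x _ => by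
          rw [AddChar.map_add_eq_mul, AddChar.map_add_eq_mul]
    simp_rw [e1]
    rw [sum_sub_distrib, sum_comm]
    conv_lhs => arg 2; rw [sum_comm]
    simp_rw [AddChar.sum_apply_eq_ite]
    have f1 : ∀ x : A, (x + -z = 0) = (x = z) := fun x => by
      rw [add_neg_eq_zero]
    have f2 : ∀ x : A, (x + (h + -z) = 0) = (x = z - h) := fun x => by
      apply propext; constructor <;> intro hx
      · have := add_neg_eq_zero.1 (show (x + h) + -z = 0 by rw [add_assoc]; exact hx); rw [← this]; abel
      · rw [hx]; abel
    simp_rw [f1, f2]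
    rw [sum_ite_eq' M z, sum_ite_eq' P (z - h)]
    split_ifs <;> ring
  -- each term of the combined sum vanishes
  have hz : ∑ ψ : AddChar A ℂ, ((∑ x ∈ M, ψ x) - ψ h * ∑ x ∈ P, ψ x) *
      (ψ (-y) - ψ (-(y + u)) - ψ (-(y + v)) + ψ (-(y + u + v))) = 0 := by
    refine sum_eq_zero fun ψ _ => ?_
    have e : ψ (-y) - ψ (-(y + u)) - ψ (-(y + v)) + ψ (-(y + u + v)) =
        ψ (-y) * (1 - ψ (-u)) * (1 - ψ (-v)) := by
      rw [show -(y + u) = -y + -u by abel, show -(y + v) = -y + -v by abel,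
        show -(y + u + v) = -y + -u + -v by abel, AddChar.map_add_eq_mul, AddChar.map_add_eq_mul,
        AddChar.map_add_eq_mul, AddChar.map_add_eq_mul]
      ring
    rw [e]
    by_cases hψu : ψ u = 1
    · have : ψ (-u) = 1 := by have := addChar_mul_neg ψ u; rw [hψu, one_mul] at this; exact this
      rw [this]; ring
    by_cases hψv : ψ v = 1
    · have : ψ (-v) = 1 := by have := addChar_mul_neg ψ v; rw [hψv, one_mul] at this; exact this
      rw [this]; ring
    rw [hMP ψ hψu hψv, sub_self, zero_mul]
  have expand : ∑ ψ : AddChar A ℂ, ((∑ x ∈ M, ψ x) - ψ h * ∑ x ∈ P, ψ x) *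
      (ψ (-y) - ψ (-(y + u)) - ψ (-(y + v)) + ψ (-(y + u + v))) =
      (∑ ψ : AddChar A ℂ, ((∑ x ∈ M, ψ x) - ψ h * ∑ x ∈ P, ψ x) * ψ (-y)) -
      (∑ ψ : AddChar A ℂ, ((∑ x ∈ M, ψ x) - ψ h * ∑ x ∈ P, ψ x) * ψ (-(y + u))) -
      (∑ ψ : AddChar A ℂ, ((∑ x ∈ M, ψ x) - ψ h * ∑ x ∈ P, ψ x) * ψ (-(y + v))) +
      (∑ ψ : AddChar A ℂ, ((∑ x ∈ M, ψ x) - ψ h * ∑ x ∈ P, ψ x) * ψ (-(y + u + v))) := by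
    rw [← sum_sub_distrib, ← sum_sub_distrib, ← sum_add_distrib]
    exact sum_congr rfl fun ψ _ => by ring
  rw [expand, key, key, key, key, ← mul_sub, ← mul_sub, ← mul_add] at hz
  have hN : (Fintype.card A : ℂ) ≠ 0 := Nat.cast_ne_zero.2 Fintype.card_ne_zero
  have hz' := (mul_eq_zero.1 hz).resolve_left hN
  rw [show y + u + v - h = y + u + v - h from rfl] at hz'
  exact_mod_cast hz'

/-- **Lemma Q, generic case: `u + v = 2t′` generates.**  Indicator forms of (i), (ii′), `|M| = 2|P|`,
`|A| = 2|M| + 2|P| + 1`, and `t′ ≠ t`: then `⟨(t′ − t) + (t + t′)⟩ = A`. [folklore] -/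
theorem zmultiples_add_eq_top_of_near_tilings {M P : Finset A} {t t' x₀ x₀' : A}
    (hi : ∀ y : A, ((if y ∈ M then (1 : ℤ) else 0) + (if y - t ∈ M then 1 else 0) + (if y ∈ P then 1 else 0) +
      (if y - t' ∈ P then 1 else 0)) = if y = x₀ then 0 else 1)
    (hii : ∀ y : A, ((if y ∈ M then (1 : ℤ) else 0) + (if y - t' ∈ M then 1 else 0) + (if y - t' ∈ P then 1 else 0) +
      (if y - (t' - t) ∈ P then 1 else 0)) = if y = x₀' then 0 else 1)
    (hMP : M.card = 2 * P.card) (hN : Fintype.card A = 2 * M.card + 2 * P.card + 1)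
    (hu : t' - t ≠ 0) :
    AddSubgroup.zmultiples ((t' - t) + (t + t')) = ⊤ := by
  have hodd : Odd (Fintype.card A) := ⟨M.card + P.card, by rw [hN]; ring⟩
  -- `A = ⟨u⟩ ⊕ ⟨v⟩`
  have hsumA : ∀ y : A, ∃ a ∈ AddSubgroup.zmultiples (t' - t), ∃ b ∈ AddSubgroup.zmultiples (t + t'),
      a + b = y := exists_add_eq_of_near_tiling hi hodd
  have hinf : ∀ w : A, w ∈ AddSubgroup.zmultiples (t' - t) → w ∈ AddSubgroup.zmultiples (t + t') → w = 0 :=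
    fun w h1 h2 => eq_zero_of_mem_zmultiples_of_near_tilings hi hii hMP hN h1 h2
  -- Steps 2–3
  obtain ⟨-, hchar⟩ := charsum_eq_of_near_tilings hi hii hN hu
  set h := x₀' - x₀ with hh
  -- names
  set u := t' - t with hu_def
  set v := t + t' with hv_def
  set k₁ := addOrderOf u with hk₁
  set k₂ := addOrderOf v with hk₂
  set D : A → ℤ := fun z => (if z ∈ M then 1 else 0) - (if z - h ∈ P then 1 else 0) with hD
  -- the mixed second difference of `D` vanishes
  have hE : ∀ z : A, D z - D (z + u) - D (z + v) + D (z + u + v) = 0 :=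
    fun z => mixed_diff_eq_zero_of_charsum_eq (fun ψ hψu hψv => hchar ψ hψu hψv) z
  -- `v`-differences are `u`-invariant
  have T1 : ∀ (z : A) (i : ℕ), D (z + i • u + v) - D (z + i • u) = D (z + v) - D z := by
    intro z i
    induction i with
    | zero => simp
    | succ i ih =>
      have e := hE (z + i • u)
      have e2 : z + (i + 1) • u = z + i • u + u := by rw [succ_nsmul, add_assoc]
      rw [e2]
      linarith
  -- `u`-orbit sums
  have T2 : ∀ z : A, ∑ i ∈ range k₁, D (z + v + i • u) =
      ∑ i ∈ range k₁, D (z + i • u) + k₁ * (D (z + v) - D z) := by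
    intro z
    have e : ∀ i ∈ range k₁, D (z + v + i • u) = D (z + i • u) + (D (z + v) - D z) := by
      intro i _
      have := T1 z i
      rw [show z + v + i • u = z + i • u + v by abel]
      linarith
    rw [sum_congr rfl e, sum_add_distrib, sum_const, card_range, nsmul_eq_mul]
  have T3 : ∀ (z : A) (j : ℕ), ∑ i ∈ range k₁, D (z + j • v + i • u) =
      ∑ i ∈ range k₁, D (z + i • u) + k₁ * (D (z + j • v) - D z) := by
    intro z j
    induction j with
    | zero => simp
    | succ j ih =>
      have e2 : z + (j + 1) • v = z + j • v + v := by rw [succ_nsmul, add_assoc]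
      rw [e2, T2 (z + j • v), ih]
      ring
  -- the parametrisation `(i, j) ↦ i•u + j•v` of `A`
  set f : ℕ × ℕ → A := fun p => p.1 • u + p.2 • v with hf
  have hinj : Set.InjOn f ↑(range k₁ ×ˢ range k₂) := by
    rintro ⟨i, j⟩ hij ⟨i', j'⟩ hij' he
    rw [coe_product, Set.mem_prod, mem_coe, mem_coe, mem_range, mem_range] at hij hij'
    simp only [hf] at he
    have hw : i • u - i' • u = j' • v - j • v := by
      rw [sub_eq_sub_iff_add_eq_add]; rw [he]; abel
    have hwu : i • u - i' • u ∈ AddSubgroup.zmultiples u :=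
      (AddSubgroup.zmultiples u).sub_mem ((AddSubgroup.zmultiples u).nsmul_mem (AddSubgroup.mem_zmultiples u) i)
        ((AddSubgroup.zmultiples u).nsmul_mem (AddSubgroup.mem_zmultiples u) i')
    have hwv : i • u - i' • u ∈ AddSubgroup.zmultiples v := by
      rw [hw]
      exact (AddSubgroup.zmultiples v).sub_mem
        ((AddSubgroup.zmultiples v).nsmul_mem (AddSubgroup.mem_zmultiples v) j')
        ((AddSubgroup.zmultiples v).nsmul_mem (AddSubgroup.mem_zmultiples v) j)
    have h0 := hinf _ hwu hwv
    have hii' : i • u = i' • u := sub_eq_zero.1 h0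
    have hi_eq : i = i' := nsmul_injOn_Iio_addOrderOf (Set.mem_Iio.2 hij.1) (Set.mem_Iio.2 hij'.1) hii'
    subst hi_eq
    have hjj' : j • v = j' • v := add_left_cancel he
    have hj_eq : j = j' := nsmul_injOn_Iio_addOrderOf (Set.mem_Iio.2 hij.2) (Set.mem_Iio.2 hij'.2) hjj'
    rw [hj_eq]
  have hsurj : (range k₁ ×ˢ range k₂).image f = univ := by
    apply eq_univ_of_forall
    intro y
    obtain ⟨a, ha, b, hb, hab⟩ := hsumA y
    obtain ⟨i, hi1, rfl⟩ := mem_image.1 ((mem_zmultiples_iff_mem_range_addOrderOf).1 ha)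
    obtain ⟨j, hj1, rfl⟩ := mem_image.1 ((mem_zmultiples_iff_mem_range_addOrderOf).1 hb)
    exact mem_image.2 ⟨(i, j), mem_product.2 ⟨hi1, hj1⟩, hab⟩
  have hcardN : k₁ * k₂ = Fintype.card A := by
    have := card_image_of_injOn hinj
    rw [hsurj, card_univ, card_product, card_range, card_range] at this
    exact this.symm
  -- total sum of `D`
  have hDsum : ∑ z : A, D z = P.card := by
    have e1 : ∑ z : A, (if z ∈ M then (1 : ℤ) else 0) = M.card := by
      rw [sum_ite_mem, univ_inter, sum_const, nsmul_eq_mul, mul_one]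
    have e2 : ∑ z : A, (if z - h ∈ P then (1 : ℤ) else 0) = P.card := by
      have e3 : ∀ z : A, (if z - h ∈ P then (1 : ℤ) else 0) = if z ∈ P.image (· + h) then 1 else 0 := by
        intro z; simp only [mem_image_add]
      rw [sum_congr rfl fun z _ => e3 z, sum_ite_mem, univ_inter, sum_const, nsmul_eq_mul, mul_one,
        card_image_add]
    simp only [hD]
    rw [sum_sub_distrib, e1, e2, hMP]; push_cast; ring
  have hbig : ∑ j ∈ range k₂, ∑ i ∈ range k₁, D (0 + j • v + i • u) = ∑ z : A, D z := by
    rw [← hsurj, sum_image hinj, sum_product_right]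
    refine sum_congr rfl fun j _ => sum_congr rfl fun i _ => ?_
    simp only [hf]
    congr 1; abel
  have htele : ∑ j ∈ range k₂, ∑ i ∈ range k₁, D (0 + j • v + i • u) =
      k₂ * ∑ i ∈ range k₁, D (0 + i • u) + k₁ * ∑ j ∈ range k₂, (D (0 + j • v) - D 0) := by
    rw [sum_congr rfl fun j _ => T3 0 j, sum_add_distrib, sum_const, card_range, nsmul_eq_mul, ← mul_sum]
  -- `gcd(k₁, k₂) ∣ |P|` and `∣ |A| = 6|P| + 1`
  have hgm : ((Nat.gcd k₁ k₂ : ℕ) : ℤ) ∣ (P.card : ℤ) := by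
    rw [← hDsum, ← hbig, htele]
    exact dvd_add (dvd_mul_of_dvd_left (Int.natCast_dvd_natCast.2 (Nat.gcd_dvd_right k₁ k₂)) _)
      (dvd_mul_of_dvd_left (Int.natCast_dvd_natCast.2 (Nat.gcd_dvd_left k₁ k₂)) _)
  have hgm' : Nat.gcd k₁ k₂ ∣ P.card := Int.natCast_dvd_natCast.1 hgm
  have hgN : Nat.gcd k₁ k₂ ∣ Fintype.card A := (Nat.gcd_dvd_left k₁ k₂).trans addOrderOf_dvd_card
  have hN' : Fintype.card A = 6 * P.card + 1 := by rw [hN, hMP]; ring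
  rw [hN'] at hgN
  have hcop : Nat.Coprime k₁ k₂ := Nat.dvd_one.1 ((Nat.dvd_add_right (dvd_mul_of_dvd_right hgm' 6)).1 hgN)
  -- `ord(u + v) = k₁ k₂ = |A|`
  have hord : addOrderOf (u + v) = Fintype.card A := by
    rw [(AddCommute.all u v).addOrderOf_add_eq_mul_addOrderOf_of_coprime hcop]; exact hcardN
  have hfull : (univ.filter fun y : A => y - 0 ∈ AddSubgroup.zmultiples (u + v)) = univ := by
    apply eq_univ_of_card
    rw [card_filter_sub_mem_zmultiples, hord]
  rw [eq_top_iff]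
  intro y _
  have hy : y ∈ univ.filter fun y : A => y - 0 ∈ AddSubgroup.zmultiples (u + v) := by rw [hfull]; exact mem_univ y
  simpa using (mem_filter.1 hy).2

/-- **Cube pair near-tilings force `A` cyclic.**  Indicator forms of (i), (ii′) with `|M| = 2|P|`,
`|A| = 2|M| + 2|P| + 1` ⇒ `A = ⟨g⟩` for some `g` (`g = t` if `t′ = t`, else `g = 2t′`). [folklore] -/
theorem exists_zmultiples_eq_top_of_near_tilings {M P : Finset A} {t t' x₀ x₀' : A}
    (hi : ∀ y : A, ((if y ∈ M then (1 : ℤ) else 0) + (if y - t ∈ M then 1 else 0) + (if y ∈ P then 1 else 0) +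
      (if y - t' ∈ P then 1 else 0)) = if y = x₀ then 0 else 1)
    (hii : ∀ y : A, ((if y ∈ M then (1 : ℤ) else 0) + (if y - t' ∈ M then 1 else 0) + (if y - t' ∈ P then 1 else 0) +
      (if y - (t' - t) ∈ P then 1 else 0)) = if y = x₀' then 0 else 1)
    (hMP : M.card = 2 * P.card) (hN : Fintype.card A = 2 * M.card + 2 * P.card + 1) :
    ∃ g : A, AddSubgroup.zmultiples g = ⊤ := by
  by_cases hu : t' - t = 0
  · -- `t' = t`: domino near-factorization with `Z = M ⊔ P`
    have e : t' = t := sub_eq_zero.1 hu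
    subst e
    have hdMP : Disjoint M P := by
      rw [disjoint_left]; intro y ha hb
      have h1 := hi y
      rw [if_pos ha, if_pos hb] at h1; split_ifs at h1 <;> omega
    have hZ : Disjoint (M ∪ P) ((M ∪ P).image (· + t')) := by
      rw [disjoint_left]; intro y hy1 hy2
      rw [mem_union] at hy1
      rw [mem_image_add, mem_union] at hy2
      have h1 := hi y
      rcases hy1 with ha | ha <;> rcases hy2 with hb | hb <;> rw [if_pos ha, if_pos hb] at h1 <;>
        split_ifs at h1 <;> omega
    have hcard : Fintype.card A = 2 * (M ∪ P).card + 1 := by rw [card_union_of_disjoint hdMP]; omega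
    obtain ⟨x₁, hx₁⟩ := coset_eq_univ_of_domino_near_tiling hZ hcard
    refine ⟨t', ?_⟩
    rw [eq_top_iff]; intro y _
    have := hx₁ (y + x₁); rwa [add_sub_cancel_right] at this
  exact ⟨_, zmultiples_add_eq_top_of_near_tilings hi hii hMP hN hu⟩

end Cyclic

end Summit.MatrixMultiplication.OmegaCensus
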